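import Summits.QuantumFields.YangMills.Theorems.FluctuationComparisonRegPrIntLS2BetaPairingOfAxialLetters
import Summits.QuantumFields.YangMills.Theorems.FluctuationComparisonRegPrIntLS2BetaCritPairOfMultiplier
import Summits.QuantumFields.YangMills.Theorems.FluctuationComparisonRegPrIntLS2BetaStrataOfLetters
import HarnessLib

/-!
# S2β ∕ GAP♯∘ strata residue (H′) — MULT♮ FROM PREIMAGES WITH SMALL COVARIANT CURL: «MULT♭-ax» ⟸ (PRE) ∧ (BKG), where (PRE) =
# {`DA(U₀)` constant on the `DM`-fibres (CRIT-m♮), (RINV-curl) «every coarse `v` has a preimage `ζ` with `Σ‖curl_{U₀}ζ‖ ≤ C_R·N·‖v‖₁`», AVG₂♭-ax}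

Cell `ym3-torus` (YM ladder rung R3 = continuum `SU(2)` Yang–Mills on the three-torus — a RUNG: NOT d = 4, NOT infinite volume,
NOT a mass gap, NOT Clay).  Width seat «width 16» `ym3-torus-px16` (gen 21), FREE px helper on crux `stmt-QuantumFields-20520`
(`FluctuationComparisonRegPrIntL`), count-neutral, DEFINITION-FREE, default heartbeats.

WHAT.  The multiplier-size half MULT♮ of ✓`…PairingOfAxialLetters.critAx_of_multAx`'s input «MULT♭-ax» is NOT an operator-norm fact (an `ℓ¹` right inverse of
the `(K−J)`-fold linearised average costs `≳ N²`, UV3-NODE §75.9 (5)); it follows from the CURL FORM of the first variation (✓`…CritPairOfMultiplier.abs_firstVariation_le_curl`: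
`|DA(U₀)[ζ]| ≤ θ₀·Σ_p‖(curl_{U₀}ζ)_p‖`) once every coarse tangent `v` has a `DM`-preimage whose covariant curl is `O(N·‖v‖₁)` — the covariant column
spread (RINV-cov; bus 13:14Z) is the candidate.  ★★★ `multAx_of_preimages (G) (Ax) (hPre) (hBkg)`: «MULT♭-ax» VERBATIM (any guard `G`, any gauge
condition `Ax`) from
* (PRE): prefix, `∃ γ₁ > 0, ∃ C_R C_M ≥ 0, ∀ … ∀ U₀ ∈ argmin, ∃ DM, (∀ ζ ζ′, DM ζ = DM ζ′ → DA(U₀)[ζ] = DA(U₀)[ζ′])` (CRIT-m♮, set form — px5 g22's lane)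
  `∧ (∀ v, ∃ ζ, DM ζ = v ∧ Σ_p‖(curl_{U₀}ζ)_p‖ ≤ C_R·L^{K−J}·Σ_B‖v_B‖)` ((RINV-curl), includes «`DM` onto») `∧ AVG₂♭-ax` (px10 g23's lane, unchanged);
* (BKG): px5 g22's ✓`…BackgroundLetterOfThm1Pair` text (unchanged).
PROOF: `λ v := DA(U₀)[ζ_v]` for the chosen preimage `ζ_v`; `DA ζ = λ (DM ζ)` by fibre-constancy; `|λ v| ≤ θ₀·C_R·L^{K−J}·‖v‖₁ ≤ C₁C_R·θ_J·L^{−(K−J)}·‖v‖₁`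
with `θ₀ := C₁θ_J L^{−2(K−J)}` (`C_λ := C₁·C_R`).

HONEST SCOPE.  A DOOR over HYPOTHESIS texts; nothing of Bałaban's analysis is asserted or proved; (RINV-curl), CRIT-m♮, AVG₂♭-ax, (D-ax), «CRIT-ax», `hIrr`,
`hA`, GAP♯∘ (`stub_uniformFibreGapOrbit`), S2β, the five registered stubs of `Lines/semiclassical_s2beta.lean` (3732b7df), crux 20520, 19936, 19200 and
`YM3TorusSU2` are NOT proved; no registered stub is closed; the Yang–Mills mass gap is NOT proved.  Sorry-free, axioms standard.

References: T. Bałaban, CMP **102** (1985) 277–309 [Balaban1985Variational] (Thm 1 (8)–(10) p.279; (34) p.283); CMP **109** (1987) 249–301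
[Balaban1987RG1] ((0.21)–(0.22) p.256); CMP **122** (1989) 175–202 [Balaban1989LargeFieldI] ((1.77) p.194).
-/

set_option autoImplicit false

noncomputable section

open Set Function
open scoped Matrix.Norms.L2Operator RealInnerProductSpace
open Literature.MathematicalPhysics.QuantumLattice (su2Quat)
open Literature.MathematicalPhysics.QuantumFieldTheory.Balaban1983to89
open Literature.MathematicalPhysics.QuantumFieldTheory.Balaban1983to89.T4Continuum
open Literature.MathematicalPhysics.QuantumFieldTheory.Balaban1983to89.T3ContinuumYM3Torus
open Literature.MathematicalPhysics.QuantumFieldTheory.Balaban1983to89.T3UnitLawDensityEML (ℰp)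
open Literature.MathematicalPhysics.QuantumFieldTheory.Balaban1983to89.T3UnitScaleTilt
open Literature.MathematicalPhysics.QuantumFieldTheory.Balaban1983to89.T3TiltDescent
open Literature.MathematicalPhysics.QuantumFieldTheory.Balaban1983to89.T3Thresholds (exists_gamma_forall_θBal_le)
open Literature.MathematicalPhysics.QuantumFieldTheory.Balaban1983to89.T3MinimiserStabilityReduction (θBal_pos)
open Literature.MathematicalPhysics.QuantumFieldTheory.Balaban1983to89.T3ConstrainedMinimiser (fibre)
open Literature.MathematicalPhysics.QuantumFieldTheory.Balaban1983to89.T3PrintedRegularMinimiser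
open Literature.MathematicalPhysics.QuantumFieldTheory.Balaban1983to89.T3PrintedRegularOrbits
open Literature.MathematicalPhysics.QuantumFieldTheory.Balaban1983to89.T4ExpWindowSmallField (imVec)
open Literature.MathematicalPhysics.QuantumFieldTheory.Balaban1983to89.B15Prop1ChartSU2 (adSU2)
open Summit.QuantumFields.YangMills.Theorems.FluctuationComparisonRegPrIntLS2BetaPairingTangentSplit (tangentSplit)

namespace Summit.QuantumFields.YangMills.Theorems.FluctuationComparisonRegPrIntLS2BetaMultOfPreimages

open Summit.QuantumFields.YangMills.Theorems.FluctuationComparisonRegPrIntLS2BetaCritPairOfMultiplier (abs_firstVariation_le_curl)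

/-- ★★★ **«MULT♭-ax» FROM (PRE) = {CRIT-m♮ set form, (RINV-curl), AVG₂♭-ax} AND (BKG)**; conclusion = the `hMult` input of
✓`…PairingOfAxialLetters.critAx_of_multAx` VERBATIM (`C_λ := C₁·C_R`). [cite: Balaban1987RG1, (0.21)-(0.22) p.256; Balaban1985Variational, Thm 1 (8)-(10) p.279, (34) p.283] -/
theorem multAx_of_preimages
    (G : (F : T3Family) → (J : ℕ) → GaugeField (F.P J) 0 (Matrix.specialUnitaryGroup (Fin 2) ℂ) → Prop)
    (Ax : (F : T3Family) → (J K : ℕ) → (hJK : J ≤ K) → GaugeField (F.P K) 0 (Matrix.specialUnitaryGroup (Fin 2) ℂ) →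
      GaugeField (F.P K) 0 (Matrix.specialUnitaryGroup (Fin 2) ℂ) → Prop)
    (hPre : ∀ (L : ℕ), ∃ c₀ : ℝ, 0 < c₀ ∧ c₀ ≤ 1 ∧ ∀ (cw : ℝ), 0 < cw → cw ≤ c₀ → ∃ pS : ℝ, ∀ (b₀ p₀ : ℝ), 0 < b₀ → pS ≤ p₀ → 0 < p₀ → ∃ ε₁ : ℝ, 0 < ε₁ ∧ ∀ (ε₀ : ℝ), 0 < ε₀ → ε₀ ≤ ε₁ →
    ∃ γ₁ : ℝ, 0 < γ₁ ∧ ∃ C_R : ℝ, 0 ≤ C_R ∧ ∃ C_M : ℝ, 0 ≤ C_M ∧ ∀ (F : T3Family) (γ : ℝ), F.L = L → 0 < γ → γ ≤ γ₁ →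
      ∀ (J K : ℕ) (hJK : J ≤ K) (V : GaugeField (F.P J) 0 (Matrix.specialUnitaryGroup (Fin 2) ℂ)), PlaqSmall (θBal F.L γ (cw * b₀) p₀ J) V →
        G F J V →
        ∀ U₀ ∈ {U' : GaugeField (F.P K) 0 (Matrix.specialUnitaryGroup (Fin 2) ℂ) | U' ∈ fibre F ℰp J K hJK V ∧ U' ∈ histGood F ℰp (θBal F.L γ b₀ p₀) K J ∧
            wilsonAction4 U' = minActionRegPr F J K hJK ε₀ V},
        ∃ (DM : (PBond (F.P K) 0 → EuclideanSpace ℝ (Fin 3)) → (PBond (F.P J) 0 → EuclideanSpace ℝ (Fin 3))),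
          (∀ ζ ζ' : PBond (F.P K) 0 → EuclideanSpace ℝ (Fin 3), DM ζ = DM ζ' →
            (∑ p : Plaq (F.P K) 0, inner ℝ (imVec (su2Quat (GaugeField.plaqHol U₀ p)))
              (adSU2 (GaugeField.plaqHol U₀ p)⁻¹ (ζ ⟨p.src, p.μ⟩) + adSU2 ((GaugeField.plaqHol U₀ p)⁻¹ * U₀ ⟨p.src, p.μ⟩) (ζ ⟨p.src.shift p.μ, p.ν⟩) -
                adSU2 ((GaugeField.plaqHol U₀ p)⁻¹ * U₀ ⟨p.src, p.μ⟩ * U₀ ⟨p.src.shift p.μ, p.ν⟩ * (U₀ ⟨p.src.shift p.ν, p.μ⟩)⁻¹) (ζ ⟨p.src.shift p.ν, p.μ⟩) -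
                ζ ⟨p.src, p.ν⟩)) =
            (∑ p : Plaq (F.P K) 0, inner ℝ (imVec (su2Quat (GaugeField.plaqHol U₀ p)))
              (adSU2 (GaugeField.plaqHol U₀ p)⁻¹ (ζ' ⟨p.src, p.μ⟩) + adSU2 ((GaugeField.plaqHol U₀ p)⁻¹ * U₀ ⟨p.src, p.μ⟩) (ζ' ⟨p.src.shift p.μ, p.ν⟩) -
                adSU2 ((GaugeField.plaqHol U₀ p)⁻¹ * U₀ ⟨p.src, p.μ⟩ * U₀ ⟨p.src.shift p.μ, p.ν⟩ * (U₀ ⟨p.src.shift p.ν, p.μ⟩)⁻¹) (ζ' ⟨p.src.shift p.ν, p.μ⟩) -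
                ζ' ⟨p.src, p.ν⟩))) ∧
          (∀ v : PBond (F.P J) 0 → EuclideanSpace ℝ (Fin 3), ∃ ζ : PBond (F.P K) 0 → EuclideanSpace ℝ (Fin 3), DM ζ = v ∧
            ∑ p : Plaq (F.P K) 0, ‖adSU2 (GaugeField.plaqHol U₀ p)⁻¹ (ζ ⟨p.src, p.μ⟩) + adSU2 ((GaugeField.plaqHol U₀ p)⁻¹ * U₀ ⟨p.src, p.μ⟩) (ζ ⟨p.src.shift p.μ, p.ν⟩) -
                  adSU2 ((GaugeField.plaqHol U₀ p)⁻¹ * U₀ ⟨p.src, p.μ⟩ * U₀ ⟨p.src.shift p.μ, p.ν⟩ * (U₀ ⟨p.src.shift p.ν, p.μ⟩)⁻¹) (ζ ⟨p.src.shift p.ν, p.μ⟩) -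
                  ζ ⟨p.src, p.ν⟩‖ ≤
              C_R * (F.L : ℝ) ^ (K - J) * ∑ B : PBond (F.P J) 0, ‖v B‖) ∧
          ∀ U ∈ fibre F ℰp J K hJK V, U ∈ histGood F ℰp (θBal F.L γ b₀ p₀) K J →
            Ax F J K hJK U U₀ →
            ∑ B : PBond (F.P J) 0, ‖DM (fun ℓ => imVec (su2Quat (U ℓ * (U₀ ℓ)⁻¹))) B‖ ≤
              C_M * (((F.L : ℝ)⁻¹) ^ (K - J) * ∑ ℓ : PBond (F.P K) 0, dist1 (U ℓ * (U₀ ℓ)⁻¹) ^ 2 +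
                (F.L : ℝ) ^ (K - J) * ∑ p : Plaq (F.P K) 0, (1 - reTr ((GaugeField.plaqHol U₀ p)⁻¹ * GaugeField.plaqHol U p))))
    (hBkg : ∀ (L : ℕ), ∃ c₀ : ℝ, 0 < c₀ ∧ c₀ ≤ 1 ∧ ∀ (cw : ℝ), 0 < cw → cw ≤ c₀ → ∃ pS : ℝ, ∀ (b₀ p₀ : ℝ), 0 < b₀ → pS ≤ p₀ → 0 < p₀ → ∃ ε₁ : ℝ, 0 < ε₁ ∧ ∀ (ε₀ : ℝ), 0 < ε₀ → ε₀ ≤ ε₁ →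
    ∃ γ₁ : ℝ, 0 < γ₁ ∧ ∃ C₁ : ℝ, 0 ≤ C₁ ∧ ∀ (F : T3Family) (γ : ℝ), F.L = L → 0 < γ → γ ≤ γ₁ →
      ∀ (J K : ℕ) (hJK : J ≤ K) (V : GaugeField (F.P J) 0 (Matrix.specialUnitaryGroup (Fin 2) ℂ)), PlaqSmall (θBal F.L γ (cw * b₀) p₀ J) V →
        G F J V →
        ∀ U₀ ∈ {U' : GaugeField (F.P K) 0 (Matrix.specialUnitaryGroup (Fin 2) ℂ) | U' ∈ fibre F ℰp J K hJK V ∧ U' ∈ histGood F ℰp (θBal F.L γ b₀ p₀) K J ∧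
            wilsonAction4 U' = minActionRegPr F J K hJK ε₀ V},
        ∀ p : Plaq (F.P K) 0, dist1 (GaugeField.plaqHol U₀ p) ≤ C₁ * θBal F.L γ b₀ p₀ J * ((F.L : ℝ)⁻¹) ^ (2 * (K - J))) :
    ∀ (L : ℕ), ∃ c₀ : ℝ, 0 < c₀ ∧ c₀ ≤ 1 ∧ ∀ (cw : ℝ), 0 < cw → cw ≤ c₀ → ∃ pS : ℝ, ∀ (b₀ p₀ : ℝ), 0 < b₀ → pS ≤ p₀ → 0 < p₀ → ∃ ε₁ : ℝ, 0 < ε₁ ∧ ∀ (ε₀ : ℝ), 0 < ε₀ → ε₀ ≤ ε₁ →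
    ∃ γ₁ : ℝ, 0 < γ₁ ∧ ∃ C_lam : ℝ, 0 ≤ C_lam ∧ ∃ C_M : ℝ, 0 ≤ C_M ∧ ∀ (F : T3Family) (γ : ℝ), F.L = L → 0 < γ → γ ≤ γ₁ →
      ∀ (J K : ℕ) (hJK : J ≤ K) (V : GaugeField (F.P J) 0 (Matrix.specialUnitaryGroup (Fin 2) ℂ)), PlaqSmall (θBal F.L γ (cw * b₀) p₀ J) V →
        G F J V →
        ∀ U₀ ∈ {U' : GaugeField (F.P K) 0 (Matrix.specialUnitaryGroup (Fin 2) ℂ) | U' ∈ fibre F ℰp J K hJK V ∧ U' ∈ histGood F ℰp (θBal F.L γ b₀ p₀) K J ∧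
            wilsonAction4 U' = minActionRegPr F J K hJK ε₀ V},
        ∃ (DM : (PBond (F.P K) 0 → EuclideanSpace ℝ (Fin 3)) → (PBond (F.P J) 0 → EuclideanSpace ℝ (Fin 3)))
          (lam : (PBond (F.P J) 0 → EuclideanSpace ℝ (Fin 3)) → ℝ),
          (∀ ζ : PBond (F.P K) 0 → EuclideanSpace ℝ (Fin 3),
            (∑ p : Plaq (F.P K) 0, inner ℝ (imVec (su2Quat (GaugeField.plaqHol U₀ p)))
              (adSU2 (GaugeField.plaqHol U₀ p)⁻¹ (ζ ⟨p.src, p.μ⟩) + adSU2 ((GaugeField.plaqHol U₀ p)⁻¹ * U₀ ⟨p.src, p.μ⟩) (ζ ⟨p.src.shift p.μ, p.ν⟩) -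
                adSU2 ((GaugeField.plaqHol U₀ p)⁻¹ * U₀ ⟨p.src, p.μ⟩ * U₀ ⟨p.src.shift p.μ, p.ν⟩ * (U₀ ⟨p.src.shift p.ν, p.μ⟩)⁻¹) (ζ ⟨p.src.shift p.ν, p.μ⟩) -
                ζ ⟨p.src, p.ν⟩)) = lam (DM ζ)) ∧
          (∀ v : PBond (F.P J) 0 → EuclideanSpace ℝ (Fin 3),
            |lam v| ≤ C_lam * θBal F.L γ b₀ p₀ J * ((F.L : ℝ)⁻¹) ^ (K - J) * ∑ B : PBond (F.P J) 0, ‖v B‖) ∧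
          ∀ U ∈ fibre F ℰp J K hJK V, U ∈ histGood F ℰp (θBal F.L γ b₀ p₀) K J →
            Ax F J K hJK U U₀ →
            ∑ B : PBond (F.P J) 0, ‖DM (fun ℓ => imVec (su2Quat (U ℓ * (U₀ ℓ)⁻¹))) B‖ ≤
              C_M * (((F.L : ℝ)⁻¹) ^ (K - J) * ∑ ℓ : PBond (F.P K) 0, dist1 (U ℓ * (U₀ ℓ)⁻¹) ^ 2 +
                (F.L : ℝ) ^ (K - J) * ∑ p : Plaq (F.P K) 0, (1 - reTr ((GaugeField.plaqHol U₀ p)⁻¹ * GaugeField.plaqHol U p))) := by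
  intro L
  obtain ⟨c₁, hc₁, hc₁1, H1⟩ := hPre L
  obtain ⟨c₂, hc₂, -, H2⟩ := hBkg L
  refine ⟨min c₁ c₂, lt_min hc₁ hc₂, (min_le_left _ _).trans hc₁1, ?_⟩
  intro cw hcw hcwle
  obtain ⟨pS₁, H1⟩ := H1 cw hcw (hcwle.trans (min_le_left _ _))
  obtain ⟨pS₂, H2⟩ := H2 cw hcw (hcwle.trans (min_le_right _ _))
  refine ⟨max pS₁ pS₂, ?_⟩
  intro b₀ p₀ hb hpS hp
  obtain ⟨e₁, he₁, H1⟩ := H1 b₀ p₀ hb ((le_max_left _ _).trans hpS) hp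
  obtain ⟨e₂, he₂, H2⟩ := H2 b₀ p₀ hb ((le_max_right _ _).trans hpS) hp
  refine ⟨min e₁ e₂, lt_min he₁ he₂, ?_⟩
  intro ε₀ hε₀ hε₀le
  obtain ⟨γA, hγA, C_R, hCR, C_M, hCM, H1⟩ := H1 ε₀ hε₀ (hε₀le.trans (min_le_left _ _))
  obtain ⟨γB, hγB, C₁, hC₁, H2⟩ := H2 ε₀ hε₀ (hε₀le.trans (min_le_right _ _))
  refine ⟨min γA (min γB 1), lt_min hγA (lt_min hγB one_pos), C₁ * C_R, mul_nonneg hC₁ hCR, C_M, hCM, ?_⟩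
  intro F γ hFL hγ hγle J K hJK V hV hG U₀ hU₀
  obtain ⟨DM, hconst, hpre, hM⟩ := H1 F γ hFL hγ (hγle.trans (min_le_left _ _)) J K hJK V hV hG U₀ hU₀
  have hbkg := H2 F γ hFL hγ (hγle.trans ((min_le_right _ _).trans (min_le_left _ _))) J K hJK V hV hG U₀ hU₀
  choose R hR hRcurl using hpre
  refine ⟨DM, fun v => (∑ p : Plaq (F.P K) 0, inner ℝ (imVec (su2Quat (GaugeField.plaqHol U₀ p)))
              (adSU2 (GaugeField.plaqHol U₀ p)⁻¹ (R v ⟨p.src, p.μ⟩) + adSU2 ((GaugeField.plaqHol U₀ p)⁻¹ * U₀ ⟨p.src, p.μ⟩) (R v ⟨p.src.shift p.μ, p.ν⟩) -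
                adSU2 ((GaugeField.plaqHol U₀ p)⁻¹ * U₀ ⟨p.src, p.μ⟩ * U₀ ⟨p.src.shift p.μ, p.ν⟩ * (U₀ ⟨p.src.shift p.ν, p.μ⟩)⁻¹) (R v ⟨p.src.shift p.ν, p.μ⟩) -
                R v ⟨p.src, p.ν⟩)), ?_, ?_, hM⟩
  · intro ζ
    exact hconst ζ (R (DM ζ)) (hR (DM ζ)).symm
  · intro v
    have hγ1 : γ ≤ 1 := hγle.trans ((min_le_right _ _).trans (min_le_right _ _))
    have hθ0 : 0 ≤ θBal F.L γ b₀ p₀ J := (θBal_pos F.hL.2.le hγ hγ1 hb p₀ J).le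
    have hL0 : (0 : ℝ) < (F.L : ℝ) := by exact_mod_cast (show 0 < F.L by have := F.hL.2; omega)
    have hcurl := abs_firstVariation_le_curl U₀ hbkg (R v)
    refine hcurl.trans ?_
    have hθ₀0 : 0 ≤ C₁ * θBal F.L γ b₀ p₀ J * ((F.L : ℝ)⁻¹) ^ (2 * (K - J)) :=
      mul_nonneg (mul_nonneg hC₁ hθ0) (pow_nonneg (inv_nonneg.mpr hL0.le) _)
    refine (mul_le_mul_of_nonneg_left (hRcurl v) hθ₀0).trans (le_of_eq ?_)
    have hpow : ((F.L : ℝ)⁻¹) ^ (2 * (K - J)) * (F.L : ℝ) ^ (K - J) = ((F.L : ℝ)⁻¹) ^ (K - J) := by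
      rw [two_mul, pow_add, mul_assoc, ← mul_pow, inv_mul_cancel₀ hL0.ne', one_pow, mul_one]
    calc C₁ * θBal F.L γ b₀ p₀ J * ((F.L : ℝ)⁻¹) ^ (2 * (K - J)) * (C_R * (F.L : ℝ) ^ (K - J) * ∑ B : PBond (F.P J) 0, ‖v B‖)
        = C₁ * C_R * θBal F.L γ b₀ p₀ J * (((F.L : ℝ)⁻¹) ^ (2 * (K - J)) * (F.L : ℝ) ^ (K - J)) * ∑ B : PBond (F.P J) 0, ‖v B‖ := by ring
      _ = C₁ * C_R * θBal F.L γ b₀ p₀ J * ((F.L : ℝ)⁻¹) ^ (K - J) * ∑ B : PBond (F.P J) 0, ‖v B‖ := by rw [hpow]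

end Summit.QuantumFields.YangMills.Theorems.FluctuationComparisonRegPrIntLS2BetaMultOfPreimages

end
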